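import Literature.Analysis.FluidPDE.BesovCubicSliceEstimate
import Literature.Analysis.FluidPDE.WholeSpaceIBP
import Literature.Analysis.FluidPDE.SpaceTimeCalculus
import Literature.Analysis.FluidPDE.SuitableWeak
import HarnessLib

/-!
# Wang–Zhang 2017, Lemma 4.1, first display: `C(u, r) ≤ C(M) (E(2r)^{1/2} C(2r)^{1/3} + C(2r)^{2/3})`

Analysis/FluidPDE proof file (theorems only: no definition, no named fact). The time-integrated
form of the local `L³` estimate of W. Wang, Z. Zhang, *Blow-up of critical norms for the 3-D
Navier–Stokes equations*, Sci. China Math. 60 (2017) = arXiv:1510.02589, **Lemma 4.1** (display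
(4.1) and the line after it): for a field `u` jointly smooth on an open time interval, whose slices
are represented by tempered distributions with `‖u(t)‖_{Ḃ^{-1+3/p}_{p,∞}} ≤ M`, and every backward
cylinder `Q_{3ρ}(t₀, x₀)` inside the slab,

`C(ρ; z₀) ≤ K M (C(3ρ; z₀)^{2/3} + E(3ρ; z₀)^{1/2} C(3ρ; z₀)^{1/3})`

(`exists_cknC_le_of_eHomBesovNorm_le`; `C = cknC`, `E = cknE` with the classical gradient; the
printed ratio `2` becomes `3` because the tree's cut-off `cutoff ρ` is supported in `|x| ≤ 2ρ`).
Proof: the slice estimate `exists_lintegral_cube_mul_sq_le_of_eHomBesovNorm_le` with the cut-off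
`ζ = cutoff ρ (· - x₀)` (`= 1` on `B_ρ`, `|∇ζ| ≤ C₁/ρ`) and the frequency `2^N ≈ ρ⁻¹`, for which
`2^{-3N/p} |B_{3ρ}|^{1/6-1/p} ≲ ρ^{1/2}` and `2^{-3N/p} ρ⁻¹ |B_{3ρ}|^{1/3-1/p} ≲ 1`; then Tonelli
on `Q_ρ = ]t₀-ρ², t₀[ × B_ρ` and Hölder in time (`ENNReal.lintegral_mul_norm_pow_le`):
`∫ ρ⁻¹ ‖u‖²_{L²(B_{3ρ})} ≲ ρ² C(3ρ)^{2/3}`, `∫ ρ^{1/2} ‖∇u‖_{L²} ‖u‖_{L³} ≲ ρ² E(3ρ)^{1/2} C(3ρ)^{1/3}`,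
`∫ ‖u‖²_{L³} ≲ ρ² C(3ρ)^{2/3}`.

## References

* W. Wang, Z. Zhang, Sci. China Math. 60 (2017) 637–650 = arXiv:1510.02589, Lemma 4.1, (4.1).
  [WangZhang2016]
-/

noncomputable section

open MeasureTheory TemperedDistribution Filter Set Function Metric
open _root_.Topology
open scoped SchwartzMap ENNReal NNReal InnerProductSpace RealInnerProductSpace

namespace Literature.Analysis.FluidPDE

/-! ## Real-exponent bookkeeping -/

section Arith

/-- `ρ^a ρ^b = ρ^{a+b}` packaged for products of three powers, `ρ > 0`. [folklore] -/
theorem rpow_mul_rpow_mul_rpow {ρ : ℝ} (hρ : 0 < ρ) (a b c : ℝ) :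
    ρ ^ a * ρ ^ b * ρ ^ c = ρ ^ (a + b + c) := by
  rw [← Real.rpow_add hρ, ← Real.rpow_add hρ]

/-- `(x y)^e = x^e y^e` in `ℝ≥0∞` with the first factor real nonnegative:
`(ofReal x * y)^e = ofReal (x^e) * y^e` for `0 ≤ x`, `0 ≤ e`. [folklore] -/
theorem ofReal_mul_rpow {x e : ℝ} (hx : 0 ≤ x) (he : 0 ≤ e) (y : ℝ≥0∞) :
    (ENNReal.ofReal x * y) ^ e = ENNReal.ofReal (x ^ e) * y ^ e := by
  rw [ENNReal.mul_rpow_of_nonneg _ _ he, ENNReal.ofReal_rpow_of_nonneg hx he]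

/-- A natural power of `ρ` as a real power. [folklore] -/
theorem pow_eq_rpow_natCast' (ρ : ℝ) (n : ℕ) : ρ ^ n = ρ ^ (n : ℝ) := (Real.rpow_natCast ρ n).symm

end Arith

/-! ## Time integration of slice quantities: two Hölder steps -/

section TimeHolder

variable {X : Type*} [MeasurableSpace X] {μ : Measure X}

/-- `∫ F^{2/3} ≤ (∫ F)^{2/3} (μ X)^{1/3}` (Hölder with exponents `2/3 + 1/3 = 1`). [folklore] -/
theorem lintegral_rpow_two_thirds_le_mul_measure {F : X → ℝ≥0∞} (hF : AEMeasurable F μ) :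
    ∫⁻ x, F x ^ (2 / 3 : ℝ) ∂μ ≤ (∫⁻ x, F x ∂μ) ^ (2 / 3 : ℝ) * μ univ ^ (1 / 3 : ℝ) := by
  have h := ENNReal.lintegral_mul_norm_pow_le hF aemeasurable_const (p := 2 / 3) (q := 1 / 3)
    (by norm_num) (by norm_num) (by norm_num) (g := fun _ => (1 : ℝ≥0∞))
  simp only [ENNReal.one_rpow, mul_one, lintegral_const, one_mul] at h
  exact h

/-- `∫ G^{1/2} F^{1/3} ≤ (∫ G)^{1/2} (∫ F)^{1/3} (μ X)^{1/6}` (Hölder `1/2 + 1/3 + 1/6 = 1`, as two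
two-factor steps). [folklore] -/
theorem lintegral_rpow_half_mul_rpow_third_le_mul_measure {F G : X → ℝ≥0∞} (hF : AEMeasurable F μ)
    (hG : AEMeasurable G μ) :
    ∫⁻ x, G x ^ (1 / 2 : ℝ) * F x ^ (1 / 3 : ℝ) ∂μ ≤
      (∫⁻ x, G x ∂μ) ^ (1 / 2 : ℝ) * ((∫⁻ x, F x ∂μ) ^ (1 / 3 : ℝ) * μ univ ^ (1 / 6 : ℝ)) := by
  have h1 : ∫⁻ x, G x ^ (1 / 2 : ℝ) * F x ^ (1 / 3 : ℝ) ∂μ ≤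
      (∫⁻ x, G x ∂μ) ^ (1 / 2 : ℝ) * (∫⁻ x, F x ^ (2 / 3 : ℝ) ∂μ) ^ (1 / 2 : ℝ) := by
    have h := ENNReal.lintegral_mul_norm_pow_le hG (hF.pow_const (2 / 3 : ℝ)) (p := 1 / 2)
      (q := 1 / 2) (by norm_num) (by norm_num) (by norm_num)
    have e : ∀ x, (F x ^ (2 / 3 : ℝ)) ^ (1 / 2 : ℝ) = F x ^ (1 / 3 : ℝ) := fun x => by
      rw [← ENNReal.rpow_mul]; norm_num
    simp only [e] at h
    exact h
  refine h1.trans (mul_le_mul' le_rfl ?_)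
  calc (∫⁻ x, F x ^ (2 / 3 : ℝ) ∂μ) ^ (1 / 2 : ℝ)
      ≤ ((∫⁻ x, F x ∂μ) ^ (2 / 3 : ℝ) * μ univ ^ (1 / 3 : ℝ)) ^ (1 / 2 : ℝ) :=
        ENNReal.rpow_le_rpow (lintegral_rpow_two_thirds_le_mul_measure hF) (by norm_num)
    _ = (∫⁻ x, F x ∂μ) ^ (1 / 3 : ℝ) * μ univ ^ (1 / 6 : ℝ) := by
        rw [ENNReal.mul_rpow_of_nonneg _ _ (by norm_num), ← ENNReal.rpow_mul, ← ENNReal.rpow_mul]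
        norm_num

/-- `∫ f² ≤ (∫ f³)^{2/3} (μ X)^{1/3}` for `f ≥ 0` (natural powers). [folklore] -/
theorem lintegral_sq_le_lintegral_cube_rpow {f : X → ℝ≥0∞} (hf : AEMeasurable f μ) :
    ∫⁻ x, f x ^ 2 ∂μ ≤ (∫⁻ x, f x ^ (3 : ℕ) ∂μ) ^ (2 / 3 : ℝ) * μ univ ^ (1 / 3 : ℝ) := by
  have h := lintegral_rpow_two_thirds_le_mul_measure (hf.pow_const (3 : ℕ))
  have e : ∀ x, (f x ^ (3 : ℕ)) ^ (2 / 3 : ℝ) = f x ^ 2 := fun x => by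
    rw [← ENNReal.rpow_natCast, ← ENNReal.rpow_mul, ← ENNReal.rpow_natCast]
    norm_num
  simp only [e] at h
  exact h

end TimeHolder

/-! ## The estimate -/

section Estimate

/-- Measure of a ball of radius `3ρ` in `ℝ³`: `|B(x₀, 3ρ)| = 27 v₁ ρ³`, `v₁ = |B(0,1)|`.
[folklore] -/
theorem volume_ball_three_mul_eq_ofReal (x₀ : EuclideanSpace ℝ (Fin 3)) {ρ : ℝ} (hρ : 0 < ρ) :
    volume (ball x₀ (3 * ρ)) =
      ENNReal.ofReal (27 * (volume (ball (0 : EuclideanSpace ℝ (Fin 3)) 1)).toReal * ρ ^ 3) := by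
  rw [Measure.addHaar_ball_of_pos volume x₀ (by positivity : (0 : ℝ) < 3 * ρ),
    finrank_euclideanSpace_fin]
  rw [show (27 : ℝ) * (volume (ball (0 : EuclideanSpace ℝ (Fin 3)) 1)).toReal * ρ ^ 3 =
    (3 * ρ) ^ 3 * (volume (ball (0 : EuclideanSpace ℝ (Fin 3)) 1)).toReal by ring,
    ENNReal.ofReal_mul (by positivity), ENNReal.ofReal_toReal measure_ball_lt_top.ne]

/-- The dyadic frequency adapted to the scale `ρ`: `ρ⁻¹ ≤ 2^N ≤ 2ρ⁻¹` for some `N ∈ ℤ`.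
[folklore] -/
theorem exists_two_zpow_near_inv {ρ : ℝ} (hρ : 0 < ρ) :
    ∃ N : ℤ, ρ⁻¹ ≤ (2 : ℝ) ^ N ∧ (2 : ℝ) ^ N ≤ 2 * ρ⁻¹ := by
  obtain ⟨n, hn1, hn2⟩ := exists_mem_Ico_zpow (inv_pos.2 hρ) one_lt_two
  refine ⟨n + 1, hn2.le, ?_⟩
  rw [zpow_add_one₀ two_ne_zero, mul_comm]
  exact mul_le_mul_of_nonneg_left hn1 zero_le_two

set_option maxHeartbeats 3200000 in
/-- **Wang–Zhang 2017, Lemma 4.1, first display** (`BMO`-free rendering, classical gradient):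
for `6 ≤ p < ∞` there is `K` such that, for every field `u` jointly smooth on `]a, t₀[ × ℝ³` whose
slices are represented by realised tempered distributions `U t` with
`‖U t‖_{Ḃ^{-1+3/p}_{p,∞}} ≤ M`, and every `x₀`, `ρ > 0` with `a ≤ t₀ - (3ρ)²`,

`C(ρ; (t₀, x₀)) ≤ K M (C(3ρ)^{2/3} + E(3ρ)^{1/2} C(3ρ)^{1/3})`

at the same apex, where `E` is computed with the classical gradient `D(u t)`. Proof in the module
docstring. [cite: WangZhang2016, Lemma 4.1, (4.1)] -/
theorem exists_cknC_le_of_eHomBesovNorm_le (p : ℝ≥0∞) [Fact (1 ≤ p)] (hp6 : 6 ≤ p)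
    (hp : p ≠ ⊤) :
    ∃ K : ℝ≥0, ∀ (u : ℝ → EuclideanSpace ℝ (Fin 3) → EuclideanSpace ℝ (Fin 3))
      (U : ℝ → 𝓢'(EuclideanSpace ℝ (Fin 3), EuclideanSpace ℂ (Fin 3))) (M : ℝ≥0) (a t₀ : ℝ)
      (x₀ : EuclideanSpace ℝ (Fin 3)) (ρ : ℝ), 0 < ρ → a ≤ t₀ - (3 * ρ) ^ 2 →
      IsSmoothSpaceTimeOn (Ioo a t₀) u →
      (∀ t ∈ Ioo a t₀, IsDistributionOf (u t) (U t)) →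
      (∀ t ∈ Ioo a t₀, Tendsto (fun j : ℤ => FunctionSpaces.lowFreqCutoff j (U t)) atBot (𝓝 0)) →
      (∀ t ∈ Ioo a t₀, FunctionSpaces.eHomBesovNorm (-1 + 3 / p.toReal) p ∞ (U t) ≤ M) →
      cknC ρ (t₀, x₀) u ≤ K * M * (cknC (3 * ρ) (t₀, x₀) u ^ (2 / 3 : ℝ) +
        cknE (3 * ρ) (t₀, x₀) (fun t x => fderiv ℝ (u t) x) ^ (1 / 2 : ℝ) *
          cknC (3 * ρ) (t₀, x₀) u ^ (1 / 3 : ℝ)) := by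
  classical
  obtain ⟨K₀, hK₀⟩ := exists_lintegral_cube_mul_sq_le_of_eHomBesovNorm_le p hp6 hp
  obtain ⟨C₁, hC₁0, hC₁⟩ := exists_norm_fderiv_cutoff_le (E := EuclideanSpace ℝ (Fin 3))
  -- ### exponents and constants
  have hρr6 : 6 ≤ p.toReal := by
    have h := ENNReal.toReal_mono hp hp6
    simpa using h
  have hρrpos : 0 < p.toReal := by linarith
  set ae : ℝ := 1 / 6 - 1 / p.toReal with hae
  set be : ℝ := 1 / 3 - 1 / p.toReal with hbe
  have hae0 : 0 ≤ ae := by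
    rw [hae, sub_nonneg]; exact one_div_le_one_div_of_le (by norm_num) hρr6
  have hbe0 : 0 ≤ be := by
    rw [hbe, sub_nonneg]; exact one_div_le_one_div_of_le (by norm_num) (by linarith)
  set v₁ : ℝ := (volume (ball (0 : EuclideanSpace ℝ (Fin 3)) 1)).toReal with hv₁
  have hv₁0 : 0 ≤ v₁ := ENNReal.toReal_nonneg
  set cb : ℝ := (27 * v₁) ^ ae with hcb
  set cc : ℝ := C₁ * (27 * v₁) ^ be with hcc
  have hcb0 : 0 ≤ cb := by positivity
  have hcc0 : 0 ≤ cc := by positivity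
  set ka : ℝ := 2 * ((27 * v₁) ^ (1 / 3 : ℝ) * (9 : ℝ) ^ (2 / 3 : ℝ)) with hka
  set kb : ℝ := cb * ((3 : ℝ) ^ (1 / 2 : ℝ) * (9 : ℝ) ^ (1 / 3 : ℝ)) with hkb
  set kc : ℝ := cc * (9 : ℝ) ^ (2 / 3 : ℝ) with hkc
  have hka0 : 0 ≤ ka := by positivity
  have hkb0 : 0 ≤ kb := by positivity
  have hkc0 : 0 ≤ kc := by positivity
  refine ⟨K₀ * ⟨3 * (ka + kb + kc), by positivity⟩, ?_⟩
  intro u U M a t₀ x₀ ρ hρ ha hu hU hreal hM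
  -- ### the cylinders
  set z : ℝ × EuclideanSpace ℝ (Fin 3) := (t₀, x₀) with hz
  set I : Set ℝ := Ioo (t₀ - ρ ^ 2) t₀ with hI
  set B : Set (EuclideanSpace ℝ (Fin 3)) := ball x₀ ρ with hB
  set I₃ : Set ℝ := Ioo (t₀ - (3 * ρ) ^ 2) t₀ with hI₃
  set B₃ : Set (EuclideanSpace ℝ (Fin 3)) := ball x₀ (3 * ρ) with hB₃
  have hII₃ : I ⊆ I₃ := Ioo_subset_Ioo (by nlinarith) le_rfl
  have hI₃S : I₃ ⊆ Ioo a t₀ := Ioo_subset_Ioo ha le_rfl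
  have hIS : I ⊆ Ioo a t₀ := hII₃.trans hI₃S
  have hBB₃ : B ⊆ B₃ := ball_subset_ball (by linarith)
  have hQ : parabolicCylinder ρ z = I ×ˢ B := rfl
  have hQ₃ : parabolicCylinder (3 * ρ) z = I₃ ×ˢ B₃ := rfl
  have hvolI : volume I = ENNReal.ofReal (ρ ^ 2) := by
    rw [hI, Real.volume_Ioo]; congr 1; ring
  have hvolB₃ : volume B₃ = ENNReal.ofReal (27 * v₁ * ρ ^ 3) := volume_ball_three_mul_eq_ofReal x₀ hρ
  -- ### continuity and measurability
  have hcont : ContinuousOn (uncurry u) (Ioo a t₀ ×ˢ univ) := hu.continuousOn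
  have hcontD : ContinuousOn (fun q : ℝ × EuclideanSpace ℝ (Fin 3) => fderiv ℝ (u q.1) q.2)
      (Ioo a t₀ ×ˢ univ) := hu.continuousOn_fderiv_slice (uniqueDiffOn_Ioo a t₀)
  have hmeasIB₃ : MeasurableSet (I ×ˢ B₃) := measurableSet_Ioo.prod measurableSet_ball
  have hsubIB₃ : I ×ˢ B₃ ⊆ Ioo a t₀ ×ˢ univ := prod_mono hIS (subset_univ _)
  have hu_aem : AEMeasurable (fun q : ℝ × EuclideanSpace ℝ (Fin 3) => ‖u q.1 q.2‖ₑ)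
      ((volume.restrict I).prod (volume.restrict B₃)) := by
    rw [Measure.prod_restrict, ← Measure.volume_eq_prod]
    exact ((hcont.mono hsubIB₃).aestronglyMeasurable hmeasIB₃).aemeasurable.enorm
  have hD_aem : AEMeasurable (fun q : ℝ × EuclideanSpace ℝ (Fin 3) =>
      ENNReal.ofReal (frobeniusNormSq (fderiv ℝ (u q.1) q.2)))
      ((volume.restrict I).prod (volume.restrict B₃)) := by
    rw [Measure.prod_restrict, ← Measure.volume_eq_prod]
    have hfc : Continuous fun L : EuclideanSpace ℝ (Fin 3) →L[ℝ] EuclideanSpace ℝ (Fin 3) =>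
        frobeniusNormSq L := by
      unfold frobeniusNormSq
      fun_prop
    have hc : ContinuousOn (fun q : ℝ × EuclideanSpace ℝ (Fin 3) =>
        frobeniusNormSq (fderiv ℝ (u q.1) q.2)) (I ×ˢ B₃) :=
      hfc.comp_continuousOn (hcontD.mono hsubIB₃)
    exact ((hc.aestronglyMeasurable hmeasIB₃).aemeasurable).ennreal_ofReal
  -- the slice quantities
  set F2 : ℝ → ℝ≥0∞ := fun t => ∫⁻ x in B₃, ‖u t x‖ₑ ^ 2 with hF2
  set F3 : ℝ → ℝ≥0∞ := fun t => ∫⁻ x in B₃, ‖u t x‖ₑ ^ (3 : ℕ) with hF3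
  set DF : ℝ → ℝ≥0∞ := fun t => ∫⁻ x in B₃, ENNReal.ofReal (frobeniusNormSq (fderiv ℝ (u t) x))
    with hDF
  have hF2m : AEMeasurable F2 (volume.restrict I) := (hu_aem.pow_const 2).lintegral_prod_right'
  have hF3m : AEMeasurable F3 (volume.restrict I) :=
    (hu_aem.pow_const (3 : ℕ)).lintegral_prod_right'
  have hDFm : AEMeasurable DF (volume.restrict I) := hD_aem.lintegral_prod_right'
  -- ### the main scaled quantities
  set C₃ : ℝ≥0∞ := cknC (3 * ρ) z u with hC₃
  set E₃ : ℝ≥0∞ := cknE (3 * ρ) z (fun t x => fderiv ℝ (u t) x) with hE₃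
  have h3ρ : (0 : ℝ) < 3 * ρ := by positivity
  have hQ₃C : ∫⁻ q in parabolicCylinder (3 * ρ) z, ‖u q.1 q.2‖ₑ ^ (3 : ℕ) =
      ENNReal.ofReal ((3 * ρ) ^ 2) * C₃ := by
    rw [hC₃, cknC, ← mul_assoc, ENNReal.ofReal_pow h3ρ.le,
      ENNReal.mul_inv_cancel (pow_ne_zero _ ((ENNReal.ofReal_pos.2 h3ρ).ne'))
        (ENNReal.pow_ne_top ENNReal.ofReal_ne_top), one_mul]
  have hQ₃E : ∫⁻ q in parabolicCylinder (3 * ρ) z,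
      ENNReal.ofReal (frobeniusNormSq (fderiv ℝ (u q.1) q.2)) = ENNReal.ofReal (3 * ρ) * E₃ := by
    rw [hE₃, cknE, ← mul_assoc, ENNReal.mul_inv_cancel ((ENNReal.ofReal_pos.2 h3ρ).ne')
      ENNReal.ofReal_ne_top, one_mul]
  -- Tonelli on `I × B₃`
  have hTonelli : ∀ (G : ℝ × EuclideanSpace ℝ (Fin 3) → ℝ≥0∞),
      AEMeasurable G ((volume.restrict I).prod (volume.restrict B₃)) →
      ∫⁻ t in I, ∫⁻ x in B₃, G (t, x) = ∫⁻ q in I ×ˢ B₃, G q := by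
    intro G hG
    rw [Measure.volume_eq_prod, ← Measure.prod_restrict, lintegral_prod _ hG]
  have hIF3 : ∫⁻ t in I, F3 t ≤ ENNReal.ofReal ((3 * ρ) ^ 2) * C₃ := by
    rw [hF3]
    dsimp only
    rw [hTonelli (fun q => ‖u q.1 q.2‖ₑ ^ (3 : ℕ)) (hu_aem.pow_const _), ← hQ₃C, hQ₃]
    exact lintegral_mono_set (prod_mono hII₃ Subset.rfl)
  have hIDF : ∫⁻ t in I, DF t ≤ ENNReal.ofReal (3 * ρ) * E₃ := by
    rw [hDF]
    dsimp only
    rw [hTonelli _ hD_aem, ← hQ₃E, hQ₃]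
    exact lintegral_mono_set (prod_mono hII₃ Subset.rfl)
  have hIF2 : ∫⁻ t in I, F2 t ≤ (ENNReal.ofReal ((3 * ρ) ^ 2) * C₃) ^ (2 / 3 : ℝ) *
      ENNReal.ofReal ((27 * v₁) ^ (1 / 3 : ℝ) * ρ ^ (5 / 3 : ℝ)) := by
    rw [hF2]
    dsimp only
    rw [hTonelli (fun q => ‖u q.1 q.2‖ₑ ^ 2) (hu_aem.pow_const _)]
    have h1 := lintegral_sq_le_lintegral_cube_rpow (μ := volume.restrict (I ×ˢ B₃))
      (f := fun q : ℝ × EuclideanSpace ℝ (Fin 3) => ‖u q.1 q.2‖ₑ)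
      (by rw [Measure.volume_eq_prod, ← Measure.prod_restrict]; exact hu_aem)
    refine h1.trans ?_
    have hvol : (volume.restrict (I ×ˢ B₃)) univ ^ (1 / 3 : ℝ) =
        ENNReal.ofReal ((27 * v₁) ^ (1 / 3 : ℝ) * ρ ^ (5 / 3 : ℝ)) := by
      rw [Measure.restrict_apply_univ, Measure.volume_eq_prod, Measure.prod_prod, hvolI, hvolB₃,
        ← ENNReal.ofReal_mul (by positivity), ENNReal.ofReal_rpow_of_nonneg (by positivity)
        (by norm_num)]
      congr 1
      rw [show ρ ^ 2 * (27 * v₁ * ρ ^ 3) = (27 * v₁) * ρ ^ (5 : ℝ) by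
        rw [show (5 : ℝ) = ((5 : ℕ) : ℝ) by norm_num, Real.rpow_natCast]; ring,
        Real.mul_rpow (by positivity) (by positivity), ← Real.rpow_mul hρ.le]
      norm_num
    rw [hvol]
    gcongr
    calc ∫⁻ q in I ×ˢ B₃, ‖u q.1 q.2‖ₑ ^ (3 : ℕ) ≤ ∫⁻ q in parabolicCylinder (3 * ρ) z,
          ‖u q.1 q.2‖ₑ ^ (3 : ℕ) := by
            rw [hQ₃]; exact lintegral_mono_set (prod_mono hII₃ Subset.rfl)
      _ = ENNReal.ofReal ((3 * ρ) ^ 2) * C₃ := hQ₃C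
  -- ### the slice estimate for `t ∈ I`
  obtain ⟨N, hN1, hN2⟩ := exists_two_zpow_near_inv hρ
  have h2N : (2 : ℝ≥0∞) ^ (N : ℝ) ≤ ENNReal.ofReal (2 * ρ⁻¹) := by
    rw [← ENNReal.ofReal_ofNat 2, ENNReal.ofReal_rpow_of_pos two_pos, Real.rpow_intCast]
    exact ENNReal.ofReal_le_ofReal hN2
  have h2Nneg : (2 : ℝ≥0∞) ^ (-(3 * (N : ℝ) / p.toReal)) ≤ ENNReal.ofReal (ρ ^ (3 / p.toReal)) := by
    rw [← ENNReal.ofReal_ofNat 2, ENNReal.ofReal_rpow_of_pos two_pos]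
    refine ENNReal.ofReal_le_ofReal ?_
    have e : -(3 * (N : ℝ) / p.toReal) = (N : ℝ) * (-(3 / p.toReal)) := by ring
    rw [e, Real.rpow_mul zero_le_two, Real.rpow_intCast]
    calc ((2 : ℝ) ^ N) ^ (-(3 / p.toReal)) ≤ (ρ⁻¹) ^ (-(3 / p.toReal)) :=
          Real.rpow_le_rpow_of_nonpos (inv_pos.2 hρ) hN1 (by
            have : 0 < 3 / p.toReal := by positivity
            linarith)
      _ = ρ ^ (3 / p.toReal) := by rw [Real.inv_rpow hρ.le, ← Real.rpow_neg hρ.le, neg_neg]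
  have hslice : ∀ t ∈ I, ∫⁻ x in B, ‖u t x‖ₑ ^ (3 : ℕ) ≤
      K₀ * M * (ENNReal.ofReal (2 * ρ⁻¹) * F2 t +
        ENNReal.ofReal (cb * ρ ^ (1 / 2 : ℝ)) * (DF t ^ (1 / 2 : ℝ) * F3 t ^ (1 / 3 : ℝ)) +
        ENNReal.ofReal cc * F3 t ^ (2 / 3 : ℝ)) := by
    intro t ht
    have htS : t ∈ Ioo a t₀ := hIS ht
    -- the cut-off
    set ζ : EuclideanSpace ℝ (Fin 3) → ℝ := fun x => cutoff ρ (x - x₀) with hζ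
    have hζc : ContDiff ℝ ((⊤ : ℕ∞) : WithTop ℕ∞) ζ :=
      (contDiff_cutoff ρ).comp (contDiff_id.sub contDiff_const)
    have hζ0 : ∀ x, 0 ≤ ζ x := fun x => cutoff_nonneg _ _
    have hζ1 : ∀ x, ζ x ≤ 1 := fun x => cutoff_le_one _ _
    have hζsupp : tsupport ζ ⊆ ball x₀ (3 * ρ) := by
      intro x hx
      by_contra hxB
      rw [mem_ball, dist_eq_norm, not_lt] at hxB
      have hzero : ∀ y ∈ ball x ρ, ζ y = 0 := by
        intro y hy
        rw [mem_ball, dist_eq_norm] at hy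
        refine cutoff_eq_zero hρ ?_
        have : ‖x - x₀‖ ≤ ‖y - x₀‖ + ‖y - x‖ := by
          calc ‖x - x₀‖ = ‖(y - x₀) - (y - x)‖ := by congr 1; abel
            _ ≤ ‖y - x₀‖ + ‖y - x‖ := norm_sub_le _ _
        linarith
      have hnot : x ∉ tsupport ζ := by
        rw [notMem_tsupport_iff_eventuallyEq]
        exact Filter.eventuallyEq_of_mem (ball_mem_nhds x hρ) hzero
      exact hnot hx
    have hζL : ∀ x, ‖fderiv ℝ ζ x‖ ≤ C₁ / ρ := by
      intro x
      have hg : HasFDerivAt (cutoff ρ) (fderiv ℝ (cutoff ρ) (x - x₀)) (x - x₀) :=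
        (((contDiff_cutoff (n := 1) ρ).differentiable (by simp)) (x - x₀)).hasFDerivAt
      have hf : HasFDerivAt (fun y : EuclideanSpace ℝ (Fin 3) => y - x₀)
          (ContinuousLinearMap.id ℝ (EuclideanSpace ℝ (Fin 3))) x := (hasFDerivAt_id x).sub_const x₀
      have hd := hg.comp x hf
      have e : ζ = (cutoff ρ) ∘ (fun y : EuclideanSpace ℝ (Fin 3) => y - x₀) := rfl
      rw [e, hd.fderiv, ContinuousLinearMap.comp_id]
      exact hC₁ ρ hρ (x - x₀)
    have hζone : ∀ x ∈ B, ζ x = 1 := fun x hx => by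
      rw [hB, mem_ball, dist_eq_norm] at hx
      exact cutoff_eq_one hρ hx.le
    -- the slice estimate
    have hft : ContDiff ℝ ((⊤ : ℕ∞) : WithTop ℕ∞) (u t) := hu.contDiff_slice htS
    have h := hK₀ (u t) (U t) M ζ x₀ (3 * ρ) (C₁ / ρ) N hft (hU t htS) (hreal t htS) (hM t htS)
      hζc hζsupp hζ0 hζ1 hζL h3ρ
    -- `∫_B |u|³ ≤ ∫ |u|³ ζ²`
    have hLHS : ∫⁻ x in B, ‖u t x‖ₑ ^ (3 : ℕ) ≤ ∫⁻ x, ‖u t x‖ₑ ^ (3 : ℕ) * ENNReal.ofReal (ζ x ^ 2) := by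
      calc ∫⁻ x in B, ‖u t x‖ₑ ^ (3 : ℕ) = ∫⁻ x in B, ‖u t x‖ₑ ^ (3 : ℕ) * ENNReal.ofReal (ζ x ^ 2) := by
            refine setLIntegral_congr_fun measurableSet_ball fun x hx => ?_
            rw [hζone x hx, one_pow, ENNReal.ofReal_one, mul_one]
        _ ≤ _ := setLIntegral_le_lintegral _ _
    refine hLHS.trans (h.trans ?_)
    -- the coefficients
    have hvolB₃' : volume (ball x₀ (3 * ρ)) = ENNReal.ofReal (27 * v₁ * ρ ^ 3) := hvolB₃
    have hcoefb : (2 : ℝ≥0∞) ^ (-(3 * (N : ℝ) / p.toReal)) *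
        volume (ball x₀ (3 * ρ)) ^ (1 / 6 - 1 / p.toReal) ≤ ENNReal.ofReal (cb * ρ ^ (1 / 2 : ℝ)) := by
      rw [hvolB₃', ← hae, ENNReal.ofReal_rpow_of_nonneg (by positivity) hae0]
      calc (2 : ℝ≥0∞) ^ (-(3 * (N : ℝ) / p.toReal)) * ENNReal.ofReal ((27 * v₁ * ρ ^ 3) ^ ae)
          ≤ ENNReal.ofReal (ρ ^ (3 / p.toReal)) * ENNReal.ofReal ((27 * v₁ * ρ ^ 3) ^ ae) :=
            mul_le_mul' h2Nneg le_rfl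
        _ = ENNReal.ofReal (cb * ρ ^ (1 / 2 : ℝ)) := by
            rw [← ENNReal.ofReal_mul (by positivity)]
            congr 1
            rw [hcb, Real.mul_rpow (by positivity) (by positivity), pow_eq_rpow_natCast' ρ 3,
              ← Real.rpow_mul hρ.le]
            have e : ρ ^ (3 / p.toReal) * ((27 * v₁) ^ ae * ρ ^ ((3 : ℕ) * ae)) =
                (27 * v₁) ^ ae * (ρ ^ (3 / p.toReal) * ρ ^ ((3 : ℕ) * ae)) := by ring
            rw [e, ← Real.rpow_add hρ]
            congr 2
            rw [hae]; push_cast; ring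
    have hcoefc : (2 : ℝ≥0∞) ^ (-(3 * (N : ℝ) / p.toReal)) * ENNReal.ofReal (C₁ / ρ) *
        volume (ball x₀ (3 * ρ)) ^ (1 / 3 - 1 / p.toReal) ≤ ENNReal.ofReal cc := by
      rw [hvolB₃', ← hbe, ENNReal.ofReal_rpow_of_nonneg (by positivity) hbe0]
      calc (2 : ℝ≥0∞) ^ (-(3 * (N : ℝ) / p.toReal)) * ENNReal.ofReal (C₁ / ρ) *
            ENNReal.ofReal ((27 * v₁ * ρ ^ 3) ^ be)
          ≤ ENNReal.ofReal (ρ ^ (3 / p.toReal)) * ENNReal.ofReal (C₁ / ρ) *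
            ENNReal.ofReal ((27 * v₁ * ρ ^ 3) ^ be) := by gcongr
        _ = ENNReal.ofReal cc := by
            rw [← ENNReal.ofReal_mul (by positivity), ← ENNReal.ofReal_mul (by positivity)]
            congr 1
            rw [hcc, Real.mul_rpow (by positivity) (by positivity), pow_eq_rpow_natCast' ρ 3,
              ← Real.rpow_mul hρ.le, div_eq_mul_inv C₁ ρ, ← Real.rpow_neg_one ρ]
            have e : ρ ^ (3 / p.toReal) * (C₁ * ρ ^ (-1 : ℝ)) * ((27 * v₁) ^ be * ρ ^ ((3 : ℕ) * be)) =
                C₁ * (27 * v₁) ^ be * (ρ ^ (3 / p.toReal) * ρ ^ (-1 : ℝ) * ρ ^ ((3 : ℕ) * be)) := by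
              ring
            rw [e, rpow_mul_rpow_mul_rpow hρ]
            have e2 : 3 / p.toReal + -1 + (3 : ℕ) * be = 0 := by rw [hbe]; push_cast; ring
            rw [e2, Real.rpow_zero, mul_one]
    calc K₀ * M * ((2 : ℝ≥0∞) ^ (N : ℝ) * (∫⁻ x in ball x₀ (3 * ρ), ‖u t x‖ₑ ^ 2) +
          (2 : ℝ≥0∞) ^ (-(3 * (N : ℝ) / p.toReal)) * volume (ball x₀ (3 * ρ)) ^ (1 / 6 - 1 / p.toReal) *
            (∫⁻ x in ball x₀ (3 * ρ), ENNReal.ofReal (frobeniusNormSq (fderiv ℝ (u t) x))) ^ (1 / 2 : ℝ) *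
            (∫⁻ x in ball x₀ (3 * ρ), ‖u t x‖ₑ ^ (3 : ℕ)) ^ (1 / 3 : ℝ) +
          (2 : ℝ≥0∞) ^ (-(3 * (N : ℝ) / p.toReal)) * ENNReal.ofReal (C₁ / ρ) *
            volume (ball x₀ (3 * ρ)) ^ (1 / 3 - 1 / p.toReal) *
            (∫⁻ x in ball x₀ (3 * ρ), ‖u t x‖ₑ ^ (3 : ℕ)) ^ (2 / 3 : ℝ))
        = K₀ * M * ((2 : ℝ≥0∞) ^ (N : ℝ) * F2 t +
          ((2 : ℝ≥0∞) ^ (-(3 * (N : ℝ) / p.toReal)) * volume (ball x₀ (3 * ρ)) ^ (1 / 6 - 1 / p.toReal)) *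
            (DF t ^ (1 / 2 : ℝ) * F3 t ^ (1 / 3 : ℝ)) +
          ((2 : ℝ≥0∞) ^ (-(3 * (N : ℝ) / p.toReal)) * ENNReal.ofReal (C₁ / ρ) *
            volume (ball x₀ (3 * ρ)) ^ (1 / 3 - 1 / p.toReal)) * F3 t ^ (2 / 3 : ℝ)) := by
          rw [hF2, hF3, hDF, hB₃]; ring
      _ ≤ K₀ * M * (ENNReal.ofReal (2 * ρ⁻¹) * F2 t +
          ENNReal.ofReal (cb * ρ ^ (1 / 2 : ℝ)) * (DF t ^ (1 / 2 : ℝ) * F3 t ^ (1 / 3 : ℝ)) +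
          ENNReal.ofReal cc * F3 t ^ (2 / 3 : ℝ)) := by
          gcongr
  -- ### integration in time
  have hmain : ∫⁻ q in parabolicCylinder ρ z, ‖u q.1 q.2‖ₑ ^ (3 : ℕ) ≤
      K₀ * M * (ENNReal.ofReal (2 * ρ⁻¹) * (∫⁻ t in I, F2 t) +
        ENNReal.ofReal (cb * ρ ^ (1 / 2 : ℝ)) * (∫⁻ t in I, DF t ^ (1 / 2 : ℝ) * F3 t ^ (1 / 3 : ℝ)) +
        ENNReal.ofReal cc * (∫⁻ t in I, F3 t ^ (2 / 3 : ℝ))) := by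
    have hu_aem' : AEMeasurable (fun q : ℝ × EuclideanSpace ℝ (Fin 3) => ‖u q.1 q.2‖ₑ ^ (3 : ℕ))
        ((volume.restrict I).prod (volume.restrict B)) := by
      rw [Measure.prod_restrict, ← Measure.volume_eq_prod]
      refine (((hcont.mono ?_).aestronglyMeasurable (measurableSet_Ioo.prod measurableSet_ball)).aemeasurable.enorm.pow_const _)
      exact prod_mono hIS (subset_univ _)
    rw [hQ, Measure.volume_eq_prod, ← Measure.prod_restrict, lintegral_prod _ hu_aem']
    calc ∫⁻ t in I, ∫⁻ x in B, ‖u t x‖ₑ ^ (3 : ℕ)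
        ≤ ∫⁻ t in I, K₀ * M * (ENNReal.ofReal (2 * ρ⁻¹) * F2 t +
            ENNReal.ofReal (cb * ρ ^ (1 / 2 : ℝ)) * (DF t ^ (1 / 2 : ℝ) * F3 t ^ (1 / 3 : ℝ)) +
            ENNReal.ofReal cc * F3 t ^ (2 / 3 : ℝ)) :=
          setLIntegral_mono_ae' measurableSet_Ioo (Eventually.of_forall hslice)  -- ae form
      _ = K₀ * M * (ENNReal.ofReal (2 * ρ⁻¹) * (∫⁻ t in I, F2 t) +
            ENNReal.ofReal (cb * ρ ^ (1 / 2 : ℝ)) * (∫⁻ t in I, DF t ^ (1 / 2 : ℝ) * F3 t ^ (1 / 3 : ℝ)) +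
            ENNReal.ofReal cc * (∫⁻ t in I, F3 t ^ (2 / 3 : ℝ))) := by
          have hXm : AEMeasurable (fun t => ENNReal.ofReal (2 * ρ⁻¹) * F2 t) (volume.restrict I) :=
            hF2m.const_mul _
          have hYm : AEMeasurable (fun t => ENNReal.ofReal (cb * ρ ^ (1 / 2 : ℝ)) *
              (DF t ^ (1 / 2 : ℝ) * F3 t ^ (1 / 3 : ℝ))) (volume.restrict I) :=
            ((hDFm.pow_const _).mul (hF3m.pow_const _)).const_mul _
          have hZm : AEMeasurable (fun t => ENNReal.ofReal cc * F3 t ^ (2 / 3 : ℝ)) (volume.restrict I) :=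
            (hF3m.pow_const _).const_mul _
          have hsm : AEMeasurable (fun t => ENNReal.ofReal (2 * ρ⁻¹) * F2 t +
              ENNReal.ofReal (cb * ρ ^ (1 / 2 : ℝ)) * (DF t ^ (1 / 2 : ℝ) * F3 t ^ (1 / 3 : ℝ)) +
              ENNReal.ofReal cc * F3 t ^ (2 / 3 : ℝ)) (volume.restrict I) := (hXm.add hYm).add hZm
          have hYm' : AEMeasurable (fun t => DF t ^ (1 / 2 : ℝ) * F3 t ^ (1 / 3 : ℝ))
              (volume.restrict I) := (hDFm.pow_const _).mul (hF3m.pow_const _)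
          have hZm' : AEMeasurable (fun t => F3 t ^ (2 / 3 : ℝ)) (volume.restrict I) :=
            hF3m.pow_const _
          rw [lintegral_const_mul'' _ hsm,
            lintegral_add_right' _ hZm, lintegral_add_left' hXm,
            lintegral_const_mul'' _ hF2m,
            lintegral_const_mul'' _ hYm',
            lintegral_const_mul'' _ hZm']
  -- ### the three time integrals
  have hvolI' : (volume.restrict I) univ = ENNReal.ofReal (ρ ^ 2) := by
    rw [Measure.restrict_apply_univ, hvolI]
  -- (a)
  have hTa : ENNReal.ofReal (2 * ρ⁻¹) * ∫⁻ t in I, F2 t ≤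
      ENNReal.ofReal (ka * ρ ^ 2) * C₃ ^ (2 / 3 : ℝ) := by
    calc ENNReal.ofReal (2 * ρ⁻¹) * ∫⁻ t in I, F2 t
        ≤ ENNReal.ofReal (2 * ρ⁻¹) * ((ENNReal.ofReal ((3 * ρ) ^ 2) * C₃) ^ (2 / 3 : ℝ) *
            ENNReal.ofReal ((27 * v₁) ^ (1 / 3 : ℝ) * ρ ^ (5 / 3 : ℝ))) := mul_le_mul' le_rfl hIF2
      _ = ENNReal.ofReal (ka * ρ ^ 2) * C₃ ^ (2 / 3 : ℝ) := by
          rw [ofReal_mul_rpow (by positivity) (by norm_num)]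
          rw [show ENNReal.ofReal (2 * ρ⁻¹) * (ENNReal.ofReal (((3 * ρ) ^ 2) ^ (2 / 3 : ℝ)) * C₃ ^ (2 / 3 : ℝ) *
              ENNReal.ofReal ((27 * v₁) ^ (1 / 3 : ℝ) * ρ ^ (5 / 3 : ℝ))) =
              (ENNReal.ofReal (2 * ρ⁻¹) * ENNReal.ofReal (((3 * ρ) ^ 2) ^ (2 / 3 : ℝ)) *
              ENNReal.ofReal ((27 * v₁) ^ (1 / 3 : ℝ) * ρ ^ (5 / 3 : ℝ))) * C₃ ^ (2 / 3 : ℝ) by ring]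
          rw [← ENNReal.ofReal_mul (by positivity), ← ENNReal.ofReal_mul (by positivity)]
          congr 2
          rw [hka, show ((3 : ℝ) * ρ) ^ 2 = 9 * ρ ^ 2 by ring, Real.mul_rpow (by norm_num) (by positivity),
            pow_eq_rpow_natCast' ρ 2, ← Real.rpow_mul hρ.le, ← Real.rpow_neg_one ρ]
          have e : 2 * ρ ^ (-1 : ℝ) * ((9 : ℝ) ^ (2 / 3 : ℝ) * ρ ^ (((2 : ℕ) : ℝ) * (2 / 3))) *
              ((27 * v₁) ^ (1 / 3 : ℝ) * ρ ^ (5 / 3 : ℝ)) =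
              2 * ((27 * v₁) ^ (1 / 3 : ℝ) * (9 : ℝ) ^ (2 / 3 : ℝ)) *
                (ρ ^ (-1 : ℝ) * ρ ^ (((2 : ℕ) : ℝ) * (2 / 3)) * ρ ^ (5 / 3 : ℝ)) := by ring
          rw [e, rpow_mul_rpow_mul_rpow hρ]
          norm_num
  -- (b)
  have hTb : ENNReal.ofReal (cb * ρ ^ (1 / 2 : ℝ)) * ∫⁻ t in I, DF t ^ (1 / 2 : ℝ) * F3 t ^ (1 / 3 : ℝ) ≤
      ENNReal.ofReal (kb * ρ ^ 2) * (E₃ ^ (1 / 2 : ℝ) * C₃ ^ (1 / 3 : ℝ)) := by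
    have h1 := lintegral_rpow_half_mul_rpow_third_le_mul_measure (μ := volume.restrict I) hF3m hDFm
    rw [hvolI'] at h1
    calc ENNReal.ofReal (cb * ρ ^ (1 / 2 : ℝ)) * ∫⁻ t in I, DF t ^ (1 / 2 : ℝ) * F3 t ^ (1 / 3 : ℝ)
        ≤ ENNReal.ofReal (cb * ρ ^ (1 / 2 : ℝ)) * ((∫⁻ t in I, DF t) ^ (1 / 2 : ℝ) *
            ((∫⁻ t in I, F3 t) ^ (1 / 3 : ℝ) * ENNReal.ofReal (ρ ^ 2) ^ (1 / 6 : ℝ))) :=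
          mul_le_mul' le_rfl h1
      _ ≤ ENNReal.ofReal (cb * ρ ^ (1 / 2 : ℝ)) * ((ENNReal.ofReal (3 * ρ) * E₃) ^ (1 / 2 : ℝ) *
            ((ENNReal.ofReal ((3 * ρ) ^ 2) * C₃) ^ (1 / 3 : ℝ) * ENNReal.ofReal (ρ ^ 2) ^ (1 / 6 : ℝ))) := by
          gcongr
      _ = ENNReal.ofReal (kb * ρ ^ 2) * (E₃ ^ (1 / 2 : ℝ) * C₃ ^ (1 / 3 : ℝ)) := by
          rw [ofReal_mul_rpow (by positivity) (by norm_num), ofReal_mul_rpow (by positivity) (by norm_num),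
            ENNReal.ofReal_rpow_of_nonneg (by positivity) (by norm_num)]
          rw [show ENNReal.ofReal (cb * ρ ^ (1 / 2 : ℝ)) *
              (ENNReal.ofReal ((3 * ρ) ^ (1 / 2 : ℝ)) * E₃ ^ (1 / 2 : ℝ) *
                (ENNReal.ofReal (((3 * ρ) ^ 2) ^ (1 / 3 : ℝ)) * C₃ ^ (1 / 3 : ℝ) *
                  ENNReal.ofReal ((ρ ^ 2) ^ (1 / 6 : ℝ)))) =
              (ENNReal.ofReal (cb * ρ ^ (1 / 2 : ℝ)) * ENNReal.ofReal ((3 * ρ) ^ (1 / 2 : ℝ)) *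
                ENNReal.ofReal (((3 * ρ) ^ 2) ^ (1 / 3 : ℝ)) * ENNReal.ofReal ((ρ ^ 2) ^ (1 / 6 : ℝ))) *
                (E₃ ^ (1 / 2 : ℝ) * C₃ ^ (1 / 3 : ℝ)) by ring]
          rw [← ENNReal.ofReal_mul (by positivity), ← ENNReal.ofReal_mul (by positivity),
            ← ENNReal.ofReal_mul (by positivity)]
          congr 2
          rw [hkb, Real.mul_rpow (by norm_num) hρ.le, show ((3 : ℝ) * ρ) ^ 2 = 9 * ρ ^ 2 by ring,
            Real.mul_rpow (by norm_num) (by positivity), pow_eq_rpow_natCast' ρ 2,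
            ← Real.rpow_mul hρ.le, ← Real.rpow_mul hρ.le]
          have e : cb * ρ ^ (1 / 2 : ℝ) * ((3 : ℝ) ^ (1 / 2 : ℝ) * ρ ^ (1 / 2 : ℝ)) *
              ((9 : ℝ) ^ (1 / 3 : ℝ) * ρ ^ (((2 : ℕ) : ℝ) * (1 / 3))) * ρ ^ (((2 : ℕ) : ℝ) * (1 / 6)) =
              cb * ((3 : ℝ) ^ (1 / 2 : ℝ) * (9 : ℝ) ^ (1 / 3 : ℝ)) *
                ((ρ ^ (1 / 2 : ℝ) * ρ ^ (1 / 2 : ℝ) * ρ ^ (((2 : ℕ) : ℝ) * (1 / 3))) *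
                  ρ ^ (((2 : ℕ) : ℝ) * (1 / 6))) := by ring
          rw [e, rpow_mul_rpow_mul_rpow hρ, ← Real.rpow_add hρ]
          norm_num
  -- (c)
  have hTc : ENNReal.ofReal cc * ∫⁻ t in I, F3 t ^ (2 / 3 : ℝ) ≤
      ENNReal.ofReal (kc * ρ ^ 2) * C₃ ^ (2 / 3 : ℝ) := by
    have h1 := lintegral_rpow_two_thirds_le_mul_measure (μ := volume.restrict I) hF3m
    rw [hvolI'] at h1
    calc ENNReal.ofReal cc * ∫⁻ t in I, F3 t ^ (2 / 3 : ℝ)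
        ≤ ENNReal.ofReal cc * ((∫⁻ t in I, F3 t) ^ (2 / 3 : ℝ) * ENNReal.ofReal (ρ ^ 2) ^ (1 / 3 : ℝ)) :=
          mul_le_mul' le_rfl h1
      _ ≤ ENNReal.ofReal cc * ((ENNReal.ofReal ((3 * ρ) ^ 2) * C₃) ^ (2 / 3 : ℝ) *
            ENNReal.ofReal (ρ ^ 2) ^ (1 / 3 : ℝ)) := by gcongr
      _ = ENNReal.ofReal (kc * ρ ^ 2) * C₃ ^ (2 / 3 : ℝ) := by
          rw [ofReal_mul_rpow (by positivity) (by norm_num),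
            ENNReal.ofReal_rpow_of_nonneg (by positivity) (by norm_num)]
          rw [show ENNReal.ofReal cc * (ENNReal.ofReal (((3 * ρ) ^ 2) ^ (2 / 3 : ℝ)) * C₃ ^ (2 / 3 : ℝ) *
              ENNReal.ofReal ((ρ ^ 2) ^ (1 / 3 : ℝ))) =
              (ENNReal.ofReal cc * ENNReal.ofReal (((3 * ρ) ^ 2) ^ (2 / 3 : ℝ)) *
                ENNReal.ofReal ((ρ ^ 2) ^ (1 / 3 : ℝ))) * C₃ ^ (2 / 3 : ℝ) by ring]
          rw [← ENNReal.ofReal_mul hcc0, ← ENNReal.ofReal_mul (by positivity)]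
          congr 2
          rw [hkc, show ((3 : ℝ) * ρ) ^ 2 = 9 * ρ ^ 2 by ring, Real.mul_rpow (by norm_num) (by positivity),
            pow_eq_rpow_natCast' ρ 2, ← Real.rpow_mul hρ.le, ← Real.rpow_mul hρ.le]
          have e : cc * ((9 : ℝ) ^ (2 / 3 : ℝ) * ρ ^ (((2 : ℕ) : ℝ) * (2 / 3))) * ρ ^ (((2 : ℕ) : ℝ) * (1 / 3)) =
              cc * (9 : ℝ) ^ (2 / 3 : ℝ) * (ρ ^ (((2 : ℕ) : ℝ) * (2 / 3)) * ρ ^ (((2 : ℕ) : ℝ) * (1 / 3))) := by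
            ring
          rw [e, ← Real.rpow_add hρ]
          norm_num
  -- ### conclusion
  set k : ℝ := ka + kb + kc with hk
  have hk0 : 0 ≤ k := by positivity
  set W : ℝ≥0∞ := C₃ ^ (2 / 3 : ℝ) + E₃ ^ (1 / 2 : ℝ) * C₃ ^ (1 / 3 : ℝ) with hW
  have hsum : ∫⁻ q in parabolicCylinder ρ z, ‖u q.1 q.2‖ₑ ^ (3 : ℕ) ≤
      ENNReal.ofReal (ρ ^ 2) * (K₀ * M * (ENNReal.ofReal (3 * k) * W)) := by
    refine hmain.trans ?_
    have hka' : ENNReal.ofReal ka ≤ ENNReal.ofReal k := ENNReal.ofReal_le_ofReal (by linarith)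
    have hkb' : ENNReal.ofReal kb ≤ ENNReal.ofReal k := ENNReal.ofReal_le_ofReal (by linarith)
    have hkc' : ENNReal.ofReal kc ≤ ENNReal.ofReal k := ENNReal.ofReal_le_ofReal (by linarith)
    have hW1 : C₃ ^ (2 / 3 : ℝ) ≤ W := le_self_add
    have hW2 : E₃ ^ (1 / 2 : ℝ) * C₃ ^ (1 / 3 : ℝ) ≤ W := le_add_self
    calc K₀ * M * (ENNReal.ofReal (2 * ρ⁻¹) * (∫⁻ t in I, F2 t) +
          ENNReal.ofReal (cb * ρ ^ (1 / 2 : ℝ)) * (∫⁻ t in I, DF t ^ (1 / 2 : ℝ) * F3 t ^ (1 / 3 : ℝ)) +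
          ENNReal.ofReal cc * (∫⁻ t in I, F3 t ^ (2 / 3 : ℝ)))
        ≤ K₀ * M * (ENNReal.ofReal (ka * ρ ^ 2) * C₃ ^ (2 / 3 : ℝ) +
          ENNReal.ofReal (kb * ρ ^ 2) * (E₃ ^ (1 / 2 : ℝ) * C₃ ^ (1 / 3 : ℝ)) +
          ENNReal.ofReal (kc * ρ ^ 2) * C₃ ^ (2 / 3 : ℝ)) :=
          mul_le_mul' le_rfl (add_le_add (add_le_add hTa hTb) hTc)
      _ = ENNReal.ofReal (ρ ^ 2) * (K₀ * M * (ENNReal.ofReal ka * C₃ ^ (2 / 3 : ℝ) +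
          ENNReal.ofReal kb * (E₃ ^ (1 / 2 : ℝ) * C₃ ^ (1 / 3 : ℝ)) +
          ENNReal.ofReal kc * C₃ ^ (2 / 3 : ℝ))) := by
          rw [ENNReal.ofReal_mul hka0, ENNReal.ofReal_mul hkb0, ENNReal.ofReal_mul hkc0]
          ring
      _ ≤ ENNReal.ofReal (ρ ^ 2) * (K₀ * M * (ENNReal.ofReal k * W +
          ENNReal.ofReal k * W + ENNReal.ofReal k * W)) := by
          gcongr
      _ = ENNReal.ofReal (ρ ^ 2) * (K₀ * M * (ENNReal.ofReal (3 * k) * W)) := by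
          rw [ENNReal.ofReal_mul (by norm_num), ENNReal.ofReal_ofNat]
          ring
  -- divide by `ρ²`
  have hρ2pos : (0 : ℝ) < ρ ^ 2 := by positivity
  have hρ2 : ENNReal.ofReal (ρ ^ 2) ≠ 0 := (ENNReal.ofReal_pos.2 hρ2pos).ne'
  have hcoe : ((K₀ * ⟨3 * (ka + kb + kc), by positivity⟩ : ℝ≥0) : ℝ≥0∞) =
      K₀ * ENNReal.ofReal (3 * k) := by
    rw [ENNReal.coe_mul, hk, ENNReal.ofReal_eq_coe_nnreal (by positivity)]
    rfl
  have hC : cknC ρ z u = (ENNReal.ofReal (ρ ^ 2))⁻¹ *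
      ∫⁻ q in parabolicCylinder ρ z, ‖u q.1 q.2‖ₑ ^ (3 : ℕ) := by
    rw [cknC, ENNReal.ofReal_pow hρ.le]
  rw [hC, hcoe]
  calc (ENNReal.ofReal (ρ ^ 2))⁻¹ * ∫⁻ q in parabolicCylinder ρ z, ‖u q.1 q.2‖ₑ ^ (3 : ℕ)
      ≤ (ENNReal.ofReal (ρ ^ 2))⁻¹ * (ENNReal.ofReal (ρ ^ 2) * (K₀ * M * (ENNReal.ofReal (3 * k) * W))) :=
        mul_le_mul' le_rfl hsum
    _ = K₀ * M * (ENNReal.ofReal (3 * k) * W) := by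
        rw [← mul_assoc, ENNReal.inv_mul_cancel hρ2 ENNReal.ofReal_ne_top, one_mul]
    _ = K₀ * ENNReal.ofReal (3 * k) * M * W := by ring

end Estimate

end Literature.Analysis.FluidPDE

end
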